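import Summits.CriticalPhenomena.SAWScalingLimit.Theorems.SAWLoopFugacityFlowAvoidanceLimitSphereRatioLimitContinuum

/-!
# `stub_sphereRatioLimit` assembled from the three lattice inputs it consists of:
# lattice topology of `Ω_δ`, the uniform discrete boundary Harnack principle, interior convergence
— helper file 3 of stub `stub_sphereRatioLimit` (S3b) of line `symplectic-fermion-anchor`
(crux `SAWLoopFugacityFlow.AvoidanceLimit`, stmt-CriticalPhenomena-10649)

`F_δ(z,y) = G^c_δ(z,y)/G_δ(z,y)` is the ratio of killed-SRW Green's functions of the stub
("walk confined to `closure D'`" over "walk in `Ω_δ`", common volume `meshDomainFinset D δ`),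
`ρ(z,y) = G_{D'}(z,y)/G_D(z,y)` its continuum counterpart (written through `φ`, `Φ = Φ_A`),
`a = D.pt 0`, `b = D.pt 1`. The stub: `F_δ` is uniformly within `η` of `d = Φ'_A(0)` on the two
lattice exit spheres of every radius `r < r₀(η)`, for small `δ`.

This file isolates the EXACT published inputs. `stub_sphereRatioLimit_of_oscillation_of_interiorLimit`
(registered sub-goal) derives the stub from three hypotheses, each a separately provable
statement in the tree's vocabulary, plus the landed continuum half (`greenRatioCont_near_pts`,
helper file 1):

* (TOP) LATTICE TOPOLOGY OF A JORDAN DOMAIN — two interior points `z*, y* ∈ D` are, for all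
  small `δ`, approximated within any `s > 0` by lattice points `u, v` joined in `Ω_δ` inside the
  volume (`G_δ(u,v) > 0`). Content: for small `δ` the largest component `meshDomain D δ` contains
  the lattice points near any compact part of `D` (a lattice component cut off from the main
  body sits behind a neck of width `< 2δ` of `∂D`, and — uniform continuity of the inverse
  boundary parametrisation of the Jordan curve — such necks only cut off pieces of diameter
  `o(1)`). Provable in the tree (sizes M–L); no literature needed.
* (BHP) VANISHING OSCILLATION OF `F_δ` OVER `B(a,r) × B(b,r)` AS `r → 0`, UNIFORMLY IN SMALL
  `δ`: `∀ η > 0 ∃ r > 0 ∀ᶠ δ`, `|F_δ(z,y) − F_δ(z',y')| ≤ η` for `δz, δz' ∈ B(a,r)`,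
  `δy, δy' ∈ B(b,r)` (pairs with positive denominators). This is the UNIFORM DISCRETE BOUNDARY
  HARNACK PRINCIPLE of D. Chelkak, Y. Wan, Electron. J. Probab. 26 (2021), arXiv:1903.08045,
  §3.2, Lemma 3.7 and Corollary 3.8 — for positive discrete harmonic `H₁, H₂` on a simply
  connected discrete domain `Ω^δ ⊂ δℤ²` with Dirichlet conditions on `∂Ω^δ ∖ ∂Ω^δ_o(b,R)`,
  `max_{u,v ∈ Ω^δ ∖ Ω^δ_o(b, 2^{-q}R)} (H₁(u)/H₂(u))/(H₁(v)/H₂(v)) ≤ (1 + k^q)/(1 − k^q)` with a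
  universal `k < 1` — applied at `a` to `H₁ = G^c_δ(·,y)`, `H₂ = G_δ(·,y)` and at `b` to
  `H₁ = G^c_δ(z',·)`, `H₂ = G_δ(z',·)` (`greenEntry_comm`), with `R = ε/2`: inside the agreement
  balls the confined and the domain walks have the SAME edges (`confinedGraph_adj_iff_of_ball`),
  so both functions are harmonic for the same walk there and vanish on the part of `∂Ω_δ` inside;
  `r = 2^{-q-1} ε` with `4k^q/(1 − k^q) ≤ η`. THE deep input; not in the tree (it rests on
  D. Chelkak, *Robust discrete complex analysis: a toolbox*, Ann. Probab. 44 (2016): discrete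
  cross-ratios and extremal length, uniformly over all simply connected discrete domains).
* (INT) INTERIOR CONVERGENCE — at every pair of distinct interior reference points
  `z*, y* ∈ D'`, `F_δ(u,v) → ρ(z*,y*)` as `δu → z*`, `δv → y*`, `δ → 0` (pairs with positive
  denominator): ibid. Proposition 3.2 / Corollary 3.3 (D. Chelkak, S. Smirnov, Adv. Math. 228
  (2011), Thm. 3.9: discrete Green's functions converge under Carathéodory approximation,
  uniformly for points jointly `r`-inside) applied to `Ω_δ → D` and to the confined walk
  `→ D'`, together with conformal invariance of the continuum Green's function
  (`G_{D'}(z*,y*) = G_ℍ(Φφ⁻¹z*, Φφ⁻¹y*)`, `G_D(z*,y*) = G_ℍ(φ⁻¹z*, φ⁻¹y*)`). Not in the tree.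

Assembly (`η/3` each): continuum half at `(z*, y*)` with `|z* − a|, |y* − b| < r₀ ≤ r₀ⁱ(η/3)`;
(BHP) between the sphere pair `(z, y)` and a lattice pair `(u, v)` near `(z*, y*)` supplied by
(TOP); (INT) at `(u, v)`. The reference points exist because the marked points lie on
`frontier D ⊆ closure D` (`MarkedDomain.pt_mem_frontier`) and `D ∩ B(a,ε) ⊆ D'`.

Convention note for whoever vendors (BHP)/(INT): the tree's `discreteDomainGraph` /
`confinedGraph` kill the walk on EDGES whose closed segment leaves the closure — Chelkak's general
discrete domains `(V^Ω, E^Ω_int)` with boundary half-edges (toolbox §2.2: "one can easily remove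
this assumption") — while the printed statements are for induced subgraphs of `δℤ²`.

Sources: [ChelkakWan2021] Lemma 3.7, Cor. 3.8, Prop. 3.2, Cor. 3.3; [Chelkak2016] §2.2;
[ChelkakSmirnov2011] Thm. 3.9; [LawlerSchrammWerner2003Restriction] Prop. 4.1. No definitions.
-/

noncomputable section

open scoped BigOperators Topology symmDiff
open Filter Finset
open Literature.Probability.RandomPlanarGeometry Literature.Probability.LatticeModels

namespace Summit.CriticalPhenomena.SAWScalingLimit.Theorems.AvoidanceLimit.Anchor

/-- The marked points of a Dobrushin domain are limits of interior points: for every `ρ > 0`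
there is `z ∈ D` with `|z − D.pt i| < ρ` (`pt i ∈ frontier D ⊆ closure D`). [folklore] -/
theorem exists_mem_carrier_dist_pt_lt (D : DobrushinDomain) (i : Fin 2) {ρ : ℝ} (hρ : 0 < ρ) :
    ∃ z ∈ D.carrier, dist z (D.pt i) < ρ := by
  have h : D.pt i ∈ closure D.carrier := frontier_subset_closure (D.pt_mem_frontier i)
  rw [Metric.mem_closure_iff] at h
  obtain ⟨z, hz, hd⟩ := h ρ hρ
  exact ⟨z, hz, by rwa [dist_comm]⟩

/-- Ball agreement: a point of `D` in the ball `B(p, ε)` lies in `D'`. [folklore] -/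
theorem mem_carrier_of_ball {D D' : DobrushinDomain} {p : ℂ} {ε : ℝ}
    (hb : D'.carrier ∩ Metric.ball p ε = D.carrier ∩ Metric.ball p ε) {z : ℂ} (hz : z ∈ D.carrier)
    (hzp : dist z p < ε) : z ∈ D'.carrier := by
  have : z ∈ D'.carrier ∩ Metric.ball p ε := by rw [hb]; exact ⟨hz, hzp⟩
  exact this.1

/-- **ASSEMBLY (registered sub-goal): `stub_sphereRatioLimit` from (TOP) + (BHP) + (INT).** The
three hypotheses, in this order: (TOP) interior points of a Dobrushin domain are eventually
approximated by lattice points joined in `Ω_δ` inside the volume; (BHP) the oscillation of the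
killed-SRW ratio `F_δ = G^c_δ/G_δ` over `B(a,r) × B(b,r)` tends to `0` with `r`, uniformly in
small `δ` — the uniform discrete boundary Harnack principle of Chelkak–Wan (Lemma 3.7 /
Cor. 3.8) at the two marked points; (INT) at distinct interior reference points `z*, y* ∈ D'`,
`F_δ(u,v) → ρ(z*,y*) = G_{D'}(z*,y*)/G_D(z*,y*)` as `(δu, δv) → (z*, y*)`, `δ → 0` — interior
convergence of discrete Green's functions (ibid. Cor. 3.3, Chelkak–Smirnov 2011 Thm. 3.9) and
conformal invariance. Conclusion: the registered signature of `stub_sphereRatioLimit`, via the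
landed continuum half `greenRatioCont_near_pts` and two triangle inequalities (`η/3` each), with
`r₀ = min(r_BHP(η/3), r₀ⁱ(η/3), ε, |a − b|)/4`. [cite: ChelkakWan2021, Lemma 3.7 and Corollary 3.8 (§3.2); Corollary 3.3 (§3.1)] -/
theorem stub_sphereRatioLimit_of_oscillation_of_interiorLimit :
    (∀ (D : DobrushinDomain) (zs ys : ℂ), zs ∈ D.carrier → ys ∈ D.carrier → ∀ s : ℝ, 0 < s →
      ∀ᶠ δ in 𝓝[>] (0 : ℝ), ∃ u v : Site 2, dist (meshPoint δ u) zs < s ∧ dist (meshPoint δ v) ys < s ∧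
        0 < greenEntry (discreteDomainGraph D.carrier δ) (meshDomainFinset D.carrier δ) u v) →
    (∀ (D D' : DobrushinDomain), D'.carrier ⊆ D.carrier → D'.pt 0 = D.pt 0 → D'.pt 1 = D.pt 1 →
      (∃ ε : ℝ, 0 < ε ∧ D'.carrier ∩ Metric.ball (D.pt 0) ε = D.carrier ∩ Metric.ball (D.pt 0) ε ∧
        D'.carrier ∩ Metric.ball (D.pt 1) ε = D.carrier ∩ Metric.ball (D.pt 1) ε) →
      ∀ η : ℝ, 0 < η → ∃ r : ℝ, 0 < r ∧ ∀ᶠ δ in 𝓝[>] (0 : ℝ), ∀ z z' y y' : Site 2,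
        dist (meshPoint δ z) (D.pt 0) < r → dist (meshPoint δ z') (D.pt 0) < r →
        dist (meshPoint δ y) (D.pt 1) < r → dist (meshPoint δ y') (D.pt 1) < r →
        0 < greenEntry (discreteDomainGraph D.carrier δ) (meshDomainFinset D.carrier δ) z y →
        0 < greenEntry (discreteDomainGraph D.carrier δ) (meshDomainFinset D.carrier δ) z' y' →
        |greenEntry (confinedGraph D.carrier D'.carrier δ) (meshDomainFinset D.carrier δ) z y /
              greenEntry (discreteDomainGraph D.carrier δ) (meshDomainFinset D.carrier δ) z y -
            greenEntry (confinedGraph D.carrier D'.carrier δ) (meshDomainFinset D.carrier δ) z' y' /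
              greenEntry (discreteDomainGraph D.carrier δ) (meshDomainFinset D.carrier δ) z' y'| ≤ η) →
    (∀ (D D' : DobrushinDomain), D'.carrier ⊆ D.carrier → D'.pt 0 = D.pt 0 → D'.pt 1 = D.pt 1 →
      (∃ ε : ℝ, 0 < ε ∧ D'.carrier ∩ Metric.ball (D.pt 0) ε = D.carrier ∩ Metric.ball (D.pt 0) ε ∧
        D'.carrier ∩ Metric.ball (D.pt 1) ε = D.carrier ∩ Metric.ball (D.pt 1) ε) →
      ∀ (φ : ConformalEquiv UpperHalfPlane.upperHalfPlaneSet D.carrier), D.IsChordalUniformizing φ →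
      ∀ (A : Set ℂ), A = closure (UpperHalfPlane.upperHalfPlaneSet \
        {z | z ∈ UpperHalfPlane.upperHalfPlaneSet ∧ φ z ∈ D'.carrier}) →
      ∀ (Φ : ConformalEquiv (UpperHalfPlane.upperHalfPlaneSet \ A) UpperHalfPlane.upperHalfPlaneSet),
        IsRestrictionMap A Φ →
      ∀ zs ys : ℂ, zs ∈ D'.carrier → ys ∈ D'.carrier → zs ≠ ys →
      ∀ η : ℝ, 0 < η → ∃ s : ℝ, 0 < s ∧ ∀ᶠ δ in 𝓝[>] (0 : ℝ), ∀ u v : Site 2,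
        dist (meshPoint δ u) zs < s → dist (meshPoint δ v) ys < s →
        0 < greenEntry (discreteDomainGraph D.carrier δ) (meshDomainFinset D.carrier δ) u v →
        |greenEntry (confinedGraph D.carrier D'.carrier δ) (meshDomainFinset D.carrier δ) u v /
              greenEntry (discreteDomainGraph D.carrier δ) (meshDomainFinset D.carrier δ) u v -
            Real.log (‖Φ (φ.symm zs) - (starRingEnd ℂ) (Φ (φ.symm ys))‖ / ‖Φ (φ.symm zs) - Φ (φ.symm ys)‖) /
              Real.log (‖φ.symm zs - (starRingEnd ℂ) (φ.symm ys)‖ / ‖φ.symm zs - φ.symm ys‖)| ≤ η) →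
    ∀ (D D' : DobrushinDomain), D'.carrier ⊆ D.carrier → D'.pt 0 = D.pt 0 → D'.pt 1 = D.pt 1 →
      (∃ ε : ℝ, 0 < ε ∧ D'.carrier ∩ Metric.ball (D.pt 0) ε = D.carrier ∩ Metric.ball (D.pt 0) ε ∧
        D'.carrier ∩ Metric.ball (D.pt 1) ε = D.carrier ∩ Metric.ball (D.pt 1) ε) →
      ∀ (φ : ConformalEquiv UpperHalfPlane.upperHalfPlaneSet D.carrier), D.IsChordalUniformizing φ →
      ∀ (A : Set ℂ), A = closure (UpperHalfPlane.upperHalfPlaneSet \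
        {z | z ∈ UpperHalfPlane.upperHalfPlaneSet ∧ φ z ∈ D'.carrier}) →
      ∀ (Φ : ConformalEquiv (UpperHalfPlane.upperHalfPlaneSet \ A) UpperHalfPlane.upperHalfPlaneSet)
        (d : ℝ), IsRestrictionMap A Φ → HasRestrictionDeriv A Φ d →
      ∀ η : ℝ, 0 < η → ∃ r₀ : ℝ, 0 < r₀ ∧ ∀ r ∈ Set.Ioo (0 : ℝ) r₀, ∀ᶠ δ in 𝓝[>] (0 : ℝ),
        ∀ z y : Site 2, r ≤ dist (meshPoint δ z) (D.pt 0) → dist (meshPoint δ z) (D.pt 0) < r + δ →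
          r ≤ dist (meshPoint δ y) (D.pt 1) → dist (meshPoint δ y) (D.pt 1) < r + δ →
          0 < greenEntry (discreteDomainGraph D.carrier δ) (meshDomainFinset D.carrier δ) z y →
          |greenEntry (confinedGraph D.carrier D'.carrier δ) (meshDomainFinset D.carrier δ) z y /
              greenEntry (discreteDomainGraph D.carrier δ) (meshDomainFinset D.carrier δ) z y - d| ≤ η := by
  intro hT hB hI D D' hsub h0 h1 hball φ hφ A hA Φ d hΦ hd η hη
  obtain ⟨ε, hε, hb0, hb1⟩ := hball
  -- the continuum half (i) and the oscillation bound (BHP), both at `η/3`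
  obtain ⟨r₂, hr₂, hcont⟩ := greenRatioCont_near_pts D D' hsub h0 h1 ⟨ε, hε, hb0, hb1⟩ φ hφ A hA
    Φ d hΦ hd (η / 3) (by positivity)
  obtain ⟨r', hr', hbhp⟩ := hB D D' hsub h0 h1 ⟨ε, hε, hb0, hb1⟩ (η / 3) (by positivity)
  -- the radius `r₀`
  have hab : 0 < dist (D.pt 0) (D.pt 1) :=
    dist_pos.2 fun h => absurd (D.pt_injective h) (by decide)
  set r₀ : ℝ := min (min r' r₂) (min ε (dist (D.pt 0) (D.pt 1))) / 4 with hr₀_def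
  have hr₀ : 0 < r₀ := by positivity
  have h4r' : 4 * r₀ ≤ r' := by
    have : min (min r' r₂) (min ε (dist (D.pt 0) (D.pt 1))) ≤ r' :=
      (min_le_left _ _).trans (min_le_left _ _)
    simp only [hr₀_def]; linarith
  have h4r₂ : 4 * r₀ ≤ r₂ := by
    have : min (min r' r₂) (min ε (dist (D.pt 0) (D.pt 1))) ≤ r₂ :=
      (min_le_left _ _).trans (min_le_right _ _)
    simp only [hr₀_def]; linarith
  have h4ε : 4 * r₀ ≤ ε := by
    have : min (min r' r₂) (min ε (dist (D.pt 0) (D.pt 1))) ≤ ε :=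
      (min_le_right _ _).trans (min_le_left _ _)
    simp only [hr₀_def]; linarith
  have h4ab : 4 * r₀ ≤ dist (D.pt 0) (D.pt 1) := by
    have : min (min r' r₂) (min ε (dist (D.pt 0) (D.pt 1))) ≤ dist (D.pt 0) (D.pt 1) :=
      (min_le_right _ _).trans (min_le_right _ _)
    simp only [hr₀_def]; linarith
  -- interior reference points `zs ∈ D' ∩ B(a, r₀)`, `ys ∈ D' ∩ B(b, r₀)`, distinct
  obtain ⟨zs, hzsD, hzs⟩ := exists_mem_carrier_dist_pt_lt D 0 hr₀
  obtain ⟨ys, hysD, hys⟩ := exists_mem_carrier_dist_pt_lt D 1 hr₀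
  have hzsD' : zs ∈ D'.carrier := mem_carrier_of_ball hb0 hzsD (by linarith)
  have hysD' : ys ∈ D'.carrier := mem_carrier_of_ball hb1 hysD (by linarith)
  have hne : zs ≠ ys := by
    intro h
    rw [h] at hzs
    have h3 := dist_triangle (D.pt 0) ys (D.pt 1)
    rw [dist_comm] at hzs
    linarith
  -- (INT) at the reference points, (TOP) within `min s r₀` of them
  obtain ⟨s, hs, hint⟩ := hI D D' hsub h0 h1 ⟨ε, hε, hb0, hb1⟩ φ hφ A hA Φ hΦ zs ys hzsD' hysD'
    hne (η / 3) (by positivity)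
  have htop := hT D zs ys hzsD hysD (min s r₀) (lt_min hs hr₀)
  refine ⟨r₀, hr₀, fun r hr => ?_⟩
  have hδ : ∀ᶠ δ in 𝓝[>] (0 : ℝ), δ ∈ Set.Ioo (0 : ℝ) r₀ := Ioo_mem_nhdsGT hr₀
  filter_upwards [hbhp, hint, htop, hδ] with δ hB' hI' hT' hδr z y hz1 hz2 hy1 hy2 hpos
  obtain ⟨u, v, hu, hv, huv⟩ := hT'
  -- distances of the four lattice points to the marked points / reference points
  have hus : dist (meshPoint δ u) zs < s := lt_of_lt_of_le hu (min_le_left _ _)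
  have hvs : dist (meshPoint δ v) ys < s := lt_of_lt_of_le hv (min_le_left _ _)
  have hua : dist (meshPoint δ u) (D.pt 0) < r' := by
    have h3 := dist_triangle (meshPoint δ u) zs (D.pt 0)
    have hu' : dist (meshPoint δ u) zs < r₀ := lt_of_lt_of_le hu (min_le_right _ _)
    linarith
  have hvb : dist (meshPoint δ v) (D.pt 1) < r' := by
    have h3 := dist_triangle (meshPoint δ v) ys (D.pt 1)
    have hv' : dist (meshPoint δ v) ys < r₀ := lt_of_lt_of_le hv (min_le_right _ _)
    linarith
  have hza : dist (meshPoint δ z) (D.pt 0) < r' := by linarith [hr.2, hδr.2]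
  have hyb : dist (meshPoint δ y) (D.pt 1) < r' := by linarith [hr.2, hδr.2]
  -- the three `η/3` estimates
  have e1 := hB' z u y v hza hua hyb hvb hpos huv
  have e2 := hI' u v hus hvs huv
  have e3 := hcont zs hzsD ys hysD (by linarith) (by linarith)
  -- two triangle inequalities
  have t1 := abs_sub_le
    (greenEntry (confinedGraph D.carrier D'.carrier δ) (meshDomainFinset D.carrier δ) z y /
      greenEntry (discreteDomainGraph D.carrier δ) (meshDomainFinset D.carrier δ) z y)
    (greenEntry (confinedGraph D.carrier D'.carrier δ) (meshDomainFinset D.carrier δ) u v /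
      greenEntry (discreteDomainGraph D.carrier δ) (meshDomainFinset D.carrier δ) u v) d
  have t2 := abs_sub_le
    (greenEntry (confinedGraph D.carrier D'.carrier δ) (meshDomainFinset D.carrier δ) u v /
      greenEntry (discreteDomainGraph D.carrier δ) (meshDomainFinset D.carrier δ) u v)
    (Real.log (‖Φ (φ.symm zs) - (starRingEnd ℂ) (Φ (φ.symm ys))‖ / ‖Φ (φ.symm zs) - Φ (φ.symm ys)‖) /
      Real.log (‖φ.symm zs - (starRingEnd ℂ) (φ.symm ys)‖ / ‖φ.symm zs - φ.symm ys‖)) d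
  linarith

end Summit.CriticalPhenomena.SAWScalingLimit.Theorems.AvoidanceLimit.Anchor

end
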